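import Summits.QuantumFields.YangMills.Theorems.UnitScaleTiltHistoryTailBoundedHeightLocal
import HarnessLib

/-!
# Crux `HistoryTailL` (stmt-QuantumFields-19936) — THE SEVERITY SANDWICH AT LARGE LADDER BASE, EVERY DEPTH
# (helper for the ledger skeleton `Cruxes/HistoryTailL/Lines/sandwich_discharge.lean`, ideator line «sandwich_discharge» /
# route-QuantumFields-CovariantDischarge rev 3: the CRUDE envelope of the two remaining stubs `stub_sandwichSweepGap`, `stub_sandwichDeep`)

Cell `ym3-torus` (YM ladder rung R3 = continuum SU(2) Yang–Mills on the three-torus; NOT the Clay problem), width seat `ym-ust-19936-w5` gen 13.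

THE STATEMENT.  For every `L`, `b₀ > 0`, `p₀ > 0` there is `C` such that for every family `F` with `F.L = L`, every `0 < γ ≤ 1`, every height
`j ≤ K` and every ladder base `b` that is LARGE AGAINST THE HEIGHT, `2·(151L²)^j·b₀ ≤ b`, and every plaquette `p` of `T^{(j)}`:
`Gibbs_K{θ_b(K−j) ≤ |Ū^{j}(∂p) − 1|} ≤ C·β_{K−j}⁵·exp(−p(g_{K−j})(b₀)²)` — at EVERY depth (no coupling `N₁·j + n ≤ K`, no regime hypothesis
on `θ_{Λb}`).  In the sandwich letters (`sandwichTail_of_large_base`): the registered sandwich bound with `γ₁ = 1`, `c = 1`, `N = 5` on the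
range `j + n ≤ K` under `2·(151L²)^j·b₀ ≤ b`.

CONSEQUENCE FOR THE LINE.  In the door's severity ladder `b_k = 2^k b₀` (`CovariantDischargeSandwichCover`) the pieces with `2^k ≥ 2(151L²)^j` are
crude at every height `j`, INCLUDING the residual's deep range `K < N₁·j + n`; with `CovariantDischargeSandwichLarge.stub_sandwichLarge` (`θ_{Λb} > 1`,
✓p708497) and `sandwichBoundedDepth` (`j ≤ j₀`) this is the complete crude envelope: the covariant sweep (`stub_sandwichSweepGap`) and the organ
(`stub_sandwichDeep`) are needed only for small severity `k ≤ 1 + j·log₂(151L²)` at unbounded depth.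

THE PROOF.  Footprint locality at threshold `θ_b` (`HistoryTailBoundedHeightLocal.gibbsK_real_event_le_sum_footprint`, valid at every height) + the
per-fine-plaquette chessboard tail (`T3FinestHeightTail.gibbsMeasure_real_dist1_ge_le`): exponent `β_K(θ_b/Λ_L^j)²/4 = L^j·(b/b₀)²·p(b₀)²/(4Λ_L^{2j})`
(`Λ_L = 151L²`, `β_iθ_b² = p(b)² = (b/b₀)²·p(b₀)²` by linearity of `pFun`) `≥ L^j·p(b₀)²` once `b ≥ 2Λ_L^j b₀`; the spare factor
`exp(−(L^j − 1)p(b₀)²)` (`p(b₀) ≥ b₀`) eats the prefactor `(81L³)^j·L^{5j} ≤ L^{15j} = e^{15j·log L}` through `15j·log L ≤ (15 log L)²/(2b₀²) + b₀²j²/2`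
and `j² ≤ 2(2^j − 1) ≤ 2(L^j − 1)`.  Result: `C = 2e²⁴c₀⁻³·exp((15 log L)²/(2b₀²))`.

WHAT THIS IS NOT.  A regime helper: it proves neither registered stub, nor `HistoryTailL`, nor the rung; YM₃ on T³ is rung R3, NOT the Clay problem.

References: T. Bałaban, CMP **98** (1985) 17–51 [Balaban1985Averaging] (Prop. 1 (51) p.26); CMP **102** (1985) 255–275 [Balaban1985UV3] ((3) p.256,
(7) p.257, (71) p.273); J. Fröhlich, R. Israel, E. Lieb, B. Simon, CMP 62 (1978) [FrohlichIsraelLiebSimon1978] (Thm 4.1).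
-/

noncomputable section

open MeasureTheory
open scoped BigOperators
open Literature.MathematicalPhysics.QuantumFieldTheory.Balaban1983to89
open Literature.MathematicalPhysics.QuantumFieldTheory.Balaban1983to89.T3ContinuumYM3Torus
open Literature.MathematicalPhysics.QuantumFieldTheory.Balaban1983to89.T3UnitScaleTilt
open Literature.MathematicalPhysics.QuantumFieldTheory.Balaban1983to89.T3UnitLawDensityEML
open Literature.MathematicalPhysics.QuantumFieldTheory.Balaban1983to89.T3FinestHeightTail
open Literature.MathematicalPhysics.QuantumFieldTheory.Balaban1983to89.T3Thresholds
open Literature.MathematicalPhysics.QuantumFieldTheory.Balaban1983to89.T3ThresholdSmallness (sqrt_coupling_pos_le)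
open Summit.QuantumFields.YangMills.Theorems.HistoryTailBoundedHeight (one_le_lam lam_pos scheme_β_add one_le_scheme_β
  pow_le_scheme_β θBal_nonneg')
open Summit.QuantumFields.YangMills.Theorems.HistoryTailBoundedHeightLocal (card_planePairs gibbsK_real_event_le_sum_footprint)

namespace Summit.QuantumFields.YangMills.Theorems.CovariantDischargeSandwichLargeBase

/-! ## §1 Letters -/

section Letters

/-- `81·L⁸ ≤ L¹⁵` for `L ≥ 2` (`81 ≤ 2⁷`; private copy of the sibling file's letter, kept local so that the two regime files build
independently). [folklore] -/
private theorem eightyone_mul_pow_le {L : ℝ} (hL : 2 ≤ L) : 81 * L ^ 3 * L ^ 5 ≤ L ^ 15 := by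
  have h7 : (81 : ℝ) ≤ L ^ 7 := by
    have : (2 : ℝ) ^ 7 ≤ L ^ 7 := pow_le_pow_left₀ (by norm_num) hL 7
    nlinarith
  have h8 : 0 ≤ L ^ 8 := by positivity
  calc 81 * L ^ 3 * L ^ 5 = 81 * L ^ 8 := by ring
    _ ≤ L ^ 7 * L ^ 8 := mul_le_mul_of_nonneg_right h7 h8
    _ = L ^ 15 := by ring

/-- `j² + 2 ≤ 2^{j+1}` (naturals). [folklore] -/
theorem sq_add_two_le_two_pow_succ (j : ℕ) : j ^ 2 + 2 ≤ 2 ^ (j + 1) := by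
  induction j with
  | zero => norm_num
  | succ n ih =>
    have h2 : 2 * n + 1 ≤ 2 ^ (n + 1) := by
      have : n < 2 ^ n := Nat.lt_two_pow_self
      calc 2 * n + 1 ≤ 2 * 2 ^ n := by omega
        _ = 2 ^ (n + 1) := by rw [pow_succ]; ring
    calc (n + 1) ^ 2 + 2 = (n ^ 2 + 2) + (2 * n + 1) := by ring
      _ ≤ 2 ^ (n + 1) + 2 ^ (n + 1) := Nat.add_le_add ih h2
      _ = 2 ^ (n + 1 + 1) := by rw [pow_succ 2 (n + 1)]; ring

/-- `j² ≤ 2(M^j − 1)` for real `M ≥ 2`. [folklore] -/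
theorem sq_le_two_mul_pow_sub_one {M : ℝ} (hM : 2 ≤ M) (j : ℕ) : (j : ℝ) ^ 2 ≤ 2 * (M ^ j - 1) := by
  have h := sq_add_two_le_two_pow_succ j
  have h' : ((j : ℝ) ^ 2 + 2) ≤ (2 : ℝ) ^ (j + 1) := by exact_mod_cast h
  have hMj : (2 : ℝ) ^ j ≤ M ^ j := pow_le_pow_left₀ (by norm_num) hM j
  have h2 : (2 : ℝ) ^ (j + 1) = 2 * 2 ^ j := by ring
  rw [h2] at h'
  linarith

/-- The printed exponent dominates the profile constant: `b₀ ≤ p(g)(b₀) = b₀(1 + log g⁻¹)^{p₀}` for `0 ≤ b₀`, `0 < g ≤ 1`, `0 ≤ p₀`.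
[cite: Balaban1985UV3, (7) p.257] -/
theorem le_pFun {b₀ p₀ g : ℝ} (hb : 0 ≤ b₀) (hg : 0 < g) (hg1 : g ≤ 1) (hp : 0 ≤ p₀) : b₀ ≤ B10.pFun b₀ p₀ g := by
  unfold B10.pFun
  have hlog : 0 ≤ Real.log g⁻¹ := Real.log_nonneg (one_le_inv_iff₀.mpr ⟨hg, hg1⟩)
  have h1 : (1 : ℝ) ≤ (1 + Real.log g⁻¹) ^ p₀ := Real.one_le_rpow (by linarith) hp
  calc b₀ = b₀ * 1 := (mul_one _).symm
    _ ≤ b₀ * (1 + Real.log g⁻¹) ^ p₀ := mul_le_mul_of_nonneg_left h1 hb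

/-- `p(g)` is linear in the profile constant: `p(g)(b) = (b/b₀)·p(g)(b₀)` (`b₀ ≠ 0`). [cite: Balaban1985UV3, (7) p.257] -/
theorem pFun_eq_div_mul {b b₀ : ℝ} (hb₀ : b₀ ≠ 0) (p₀ g : ℝ) : B10.pFun b p₀ g = b / b₀ * B10.pFun b₀ p₀ g := by
  unfold B10.pFun
  field_simp

/-- THE PREFACTOR LETTER: `(81L³)^j·L^{5j} ≤ exp((15 log L)²/(2b₀²))·exp((L^j − 1)·b₀²)` for `L ≥ 2`, `b₀ > 0` — the footprint count times the
polynomial prefactor is eaten by one unit of spare Gaussian exponent per coarse area. [folklore] -/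
theorem prefactor_le_exp {L b₀ : ℝ} (hL : 2 ≤ L) (hb₀ : 0 < b₀) (j : ℕ) :
    (81 * L ^ 3) ^ j * L ^ (5 * j) ≤ Real.exp ((15 * Real.log L) ^ 2 / (2 * b₀ ^ 2)) * Real.exp ((L ^ j - 1) * b₀ ^ 2) := by
  have hL0 : 0 < L := by linarith
  -- `(81L³)^j L^{5j} ≤ L^{15j} = exp(15 j log L)`
  have h1 : (81 * L ^ 3) ^ j * L ^ (5 * j) ≤ L ^ (15 * j) := by
    have h3 : (81 * L ^ 3) ^ j * L ^ (5 * j) = (81 * L ^ 3 * L ^ 5) ^ j := by rw [pow_mul, ← mul_pow]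
    rw [h3]
    calc (81 * L ^ 3 * L ^ 5) ^ j ≤ (L ^ 15) ^ j := pow_le_pow_left₀ (by positivity) (eightyone_mul_pow_le hL) j
      _ = L ^ (15 * j) := by rw [← pow_mul]
  have h2 : L ^ (15 * j) = Real.exp (15 * j * Real.log L) := by
    rw [← Real.exp_log (pow_pos hL0 (15 * j)), Real.log_pow]
    push_cast
    ring_nf
  -- `15 j log L ≤ (15 log L)²/(2b₀²) + b₀² j²/2 ≤ (15 log L)²/(2b₀²) + b₀²(L^j − 1)`
  have hb2 : 0 < b₀ ^ 2 := by positivity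
  have hamgm : 15 * j * Real.log L ≤ (15 * Real.log L) ^ 2 / (2 * b₀ ^ 2) + b₀ ^ 2 * (j : ℝ) ^ 2 / 2 := by
    have hsq : 0 ≤ (15 * Real.log L - b₀ ^ 2 * j) ^ 2 / (2 * b₀ ^ 2) := by positivity
    have hexp : (15 * Real.log L - b₀ ^ 2 * j) ^ 2 / (2 * b₀ ^ 2) =
        (15 * Real.log L) ^ 2 / (2 * b₀ ^ 2) - 15 * j * Real.log L + b₀ ^ 2 * (j : ℝ) ^ 2 / 2 := by
      field_simp
      ring
    linarith
  have hj2 : b₀ ^ 2 * (j : ℝ) ^ 2 / 2 ≤ (L ^ j - 1) * b₀ ^ 2 := by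
    have h := sq_le_two_mul_pow_sub_one hL j
    nlinarith
  calc (81 * L ^ 3) ^ j * L ^ (5 * j) ≤ L ^ (15 * j) := h1
    _ = Real.exp (15 * j * Real.log L) := h2
    _ ≤ Real.exp ((15 * Real.log L) ^ 2 / (2 * b₀ ^ 2) + (L ^ j - 1) * b₀ ^ 2) := Real.exp_le_exp.mpr (by linarith)
    _ = Real.exp ((15 * Real.log L) ^ 2 / (2 * b₀ ^ 2)) * Real.exp ((L ^ j - 1) * b₀ ^ 2) := Real.exp_add _ _

end Letters

/-! ## §2 The per-plaquette tail at large ladder base, every height -/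

section Main

/-- **THE PER-PLAQUETTE LARGE-FIELD TAIL OF THE BLOCK-AVERAGED FIELDS AT EVERY HEIGHT, FOR LADDER BASES LARGE AGAINST THE HEIGHT.**  For every `L`,
`b₀ > 0`, `p₀ > 0` there is `C ≥ 0` such that for EVERY family `F` with `F.L = L`, every `0 < γ ≤ 1`, every base `b` with `2·(151L²)^j·b₀ ≤ b`, every
cut-off `K`, height `j ≤ K` and plaquette `p` of `T^{(j)}`: `Gibbs_K{θ_b(K−j) ≤ |Ū^{j}(∂p) − 1|} ≤ C·β_{K−j}⁵·exp(−p(g_{K−j})(b₀)²)`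
(`C = 2e²⁴c₀⁻³·exp((15 log L)²/(2b₀²))`; no coupling between `j` and `K`).  Sibling of `HistoryTailBoundedHeightLocal.perPlaquette_boundedHeight_uniform`
(every base, bounded height) and of `CovariantDischargeSandwichLarge.stub_sandwichLarge` (large threshold, coupled range).
[cite: Balaban1985Averaging, Prop. 1 (51) p.26; Balaban1985UV3, (3) p.256, (7) p.257 and (71) p.273; FrohlichIsraelLiebSimon1978, Thm 4.1] -/
theorem perPlaquette_of_large_base (L : ℕ) {b₀ p₀ : ℝ} (hb₀ : 0 < b₀) (hp₀ : 0 < p₀) :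
    ∃ C : ℝ, 0 ≤ C ∧ ∀ (F : T3Family), F.L = L → ∀ (γ : ℝ), 0 < γ → γ ≤ 1 → ∀ (b : ℝ) (K j : ℕ), j ≤ K →
      2 * (151 * (L : ℝ) ^ 2) ^ j * b₀ ≤ b → ∀ p : Plaq (F.P K) j,
        (gibbsK F ℰp γ K).real
            {U | θBal F.L γ b p₀ (K - j) ≤
              GaugeGroup.dist1 (GaugeField.plaqHol (Averaging.iter (fun _ => BlockAveraging.blockAvg ℰp) j U) p)} ≤
          C * (F.scheme ℰp γ).β (K - j) ^ 5 *
            Real.exp (-(B10.pFun b₀ p₀ (Real.sqrt (γ * ((F.L : ℝ)⁻¹) ^ (K - j))) ^ 2)) := by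
  obtain ⟨c₀, hc₀, _, hch⟩ := gibbsMeasure_real_dist1_ge_le (N := 2)
  refine ⟨2 * Real.exp 24 * (c₀ ^ 3)⁻¹ * Real.exp ((15 * Real.log L) ^ 2 / (2 * b₀ ^ 2)), by positivity,
    fun F hFL γ hγ hγ1 b K j hjK hb p => ?_⟩
  subst hFL
  have hL2 : (2 : ℝ) ≤ F.L := by exact_mod_cast F.hL.2
  have hL1 : (1 : ℝ) ≤ F.L := by linarith
  have hL1n : 1 ≤ F.L := F.hL.2.le
  haveI := isProbabilityMeasure_gibbsK F ℰp hγ.le K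
  -- names
  set i : ℕ := K - j with hi
  have hK : K = i + j := by omega
  set βi : ℝ := (F.scheme ℰp γ).β i with hβi
  set βK : ℝ := (F.scheme ℰp γ).β K with hβK
  set x : ℝ := γ * ((F.L : ℝ)⁻¹) ^ i with hx
  set pg : ℝ := B10.pFun b₀ p₀ (Real.sqrt x) with hpg
  set θ : ℝ := θBal F.L γ b p₀ i with hθ
  set Cpre : ℝ := Real.exp ((15 * Real.log (F.L : ℝ)) ^ 2 / (2 * b₀ ^ 2)) with hCpre
  have hβKeq : βK = (F.L : ℝ) ^ j * βi := by rw [hβK, hK, scheme_β_add]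
  have hβi1 : 1 ≤ βi := one_le_scheme_β F hγ hγ1 i
  have hβK1 : 1 ≤ βK := one_le_scheme_β F hγ hγ1 K
  have hΛL0 : 0 < 151 * (F.L : ℝ) ^ 2 := lam_pos F
  have hΛLj0 : 0 < (151 * (F.L : ℝ) ^ 2) ^ j := pow_pos hΛL0 j
  have hb0 : 0 < b := by
    have : 0 < 2 * (151 * (F.L : ℝ) ^ 2) ^ j * b₀ := by positivity
    linarith
  have hθ0 : 0 ≤ θ := θBal_nonneg' F hγ hγ1 hb0.le p₀ i
  -- the printed exponent and its floor `pg ≥ b₀`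
  have hg := sqrt_coupling_pos_le hL1n hγ i
  have hg1 : Real.sqrt x ≤ 1 := coupling_le_one hL1n hγ hγ1 i
  have hpg_ge : b₀ ≤ pg := le_pFun hb₀.le hg.1 hg1 hp₀.le
  have hpg0 : 0 < pg := hb₀.trans_le hpg_ge
  have hpg2 : b₀ ^ 2 ≤ pg ^ 2 := pow_le_pow_left₀ hb₀.le hpg_ge 2
  have hRHS0 : 0 ≤ 2 * Real.exp 24 * (c₀ ^ 3)⁻¹ * Cpre * βi ^ 5 * Real.exp (-(pg ^ 2)) := by positivity
  -- trivial case `θ > 2`: the event is empty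
  by_cases hθ2 : 2 < θ
  · have hempty : {U : GaugeField (F.P K) 0 (Matrix.specialUnitaryGroup (Fin 2) ℂ) |
        θ ≤ GaugeGroup.dist1 (GaugeField.plaqHol (Averaging.iter (fun _ => BlockAveraging.blockAvg ℰp) j U) p)} = ∅ := by
      ext U
      simp only [Set.mem_setOf_eq, Set.mem_empty_iff_false, iff_false, not_le]
      exact (T4PairDerivBridge.dist1_le_two_specialUnitaryGroup _).trans_lt hθ2
    rw [hempty, measureReal_empty]
    exact hRHS0
  rw [not_lt] at hθ2
  -- Step 1: the footprint cover at threshold `θ`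
  obtain ⟨T, hTcard, hTbound⟩ := gibbsK_real_event_le_sum_footprint F hγ.le hjK hθ0 hθ2 p
  refine hTbound.trans ?_
  -- Step 2: the per-fine-plaquette chessboard bound
  set a : ℝ := θ / (151 * (F.L : ℝ) ^ 2) ^ j with ha
  have ha0 : 0 ≤ a := div_nonneg hθ0 hΛLj0.le
  have hterm : ∀ q : Plaq (F.P K) 0,
      (gibbsK F ℰp γ K).real {U | a ≤ GaugeGroup.dist1 (GaugeField.plaqHol U q)} ≤
        2 * Real.exp 24 * (c₀ ^ 3)⁻¹ * Real.sqrt βK ^ 9 * Real.exp (-(βK * a ^ 2 / 4)) := by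
    intro q
    have hq := hch (F.P K) βK hβK1 a ha0 q
    rw [gibbsK_eq]
    refine hq.trans (le_of_eq ?_)
    rw [card_planePairs F K, show (F.P K).d = 3 from rfl]
    have hexp : βK * a ^ 2 / (2 * (2 : ℕ)) = βK * a ^ 2 / 4 := by norm_num
    rw [hexp]
    norm_num
  have hsum : ∑ q ∈ T, (gibbsK F ℰp γ K).real {U | θ / (151 * (F.L : ℝ) ^ 2) ^ j ≤ GaugeGroup.dist1 (GaugeField.plaqHol U q)} ≤
      T.card * (2 * Real.exp 24 * (c₀ ^ 3)⁻¹ * Real.sqrt βK ^ 9 * Real.exp (-(βK * a ^ 2 / 4))) := by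
    have h := Finset.sum_le_sum fun q (_ : q ∈ T) => hterm q
    rwa [Finset.sum_const, nsmul_eq_mul] at h
  refine hsum.trans ?_
  -- Step 3 (i): `#T·(√βK)⁹ ≤ (81L³)^j L^{5j} βi⁵ ≤ Cpre · exp((L^j − 1)pg²) · βi⁵`
  have hsqrt : Real.sqrt βK ^ 9 ≤ (F.L : ℝ) ^ (5 * j) * βi ^ 5 := by
    have hs1 : 1 ≤ Real.sqrt βK := by rw [← Real.sqrt_one]; exact Real.sqrt_le_sqrt hβK1
    have h9 : Real.sqrt βK ^ 9 ≤ Real.sqrt βK ^ 10 := pow_le_pow_right₀ hs1 (by norm_num)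
    have h10 : Real.sqrt βK ^ 10 = βK ^ 5 := by
      rw [show (10 : ℕ) = 2 * 5 from rfl, pow_mul, Real.sq_sqrt (zero_le_one.trans hβK1)]
    refine h9.trans (le_of_eq ?_)
    rw [h10, hβKeq, mul_pow, ← pow_mul, mul_comm j 5]
  have hpre : (T.card : ℝ) * Real.sqrt βK ^ 9 ≤ Cpre * Real.exp ((F.L ^ j - 1) * pg ^ 2) * βi ^ 5 := by
    have h1 : (T.card : ℝ) * Real.sqrt βK ^ 9 ≤ (81 * (F.L : ℝ) ^ 3) ^ j * ((F.L : ℝ) ^ (5 * j) * βi ^ 5) :=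
      mul_le_mul hTcard hsqrt (by positivity) (by positivity)
    have h2 : (81 * (F.L : ℝ) ^ 3) ^ j * (F.L : ℝ) ^ (5 * j) ≤ Cpre * Real.exp (((F.L : ℝ) ^ j - 1) * pg ^ 2) := by
      refine (prefactor_le_exp hL2 hb₀ j).trans ?_
      rw [hCpre]
      refine mul_le_mul_of_nonneg_left (Real.exp_le_exp.mpr ?_) (Real.exp_pos _).le
      have hLj : 0 ≤ (F.L : ℝ) ^ j - 1 := by linarith [one_le_pow₀ (n := j) hL1]
      exact mul_le_mul_of_nonneg_left hpg2 hLj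
    calc (T.card : ℝ) * Real.sqrt βK ^ 9 ≤ (81 * (F.L : ℝ) ^ 3) ^ j * ((F.L : ℝ) ^ (5 * j) * βi ^ 5) := h1
      _ = ((81 * (F.L : ℝ) ^ 3) ^ j * (F.L : ℝ) ^ (5 * j)) * βi ^ 5 := by ring
      _ ≤ (Cpre * Real.exp (((F.L : ℝ) ^ j - 1) * pg ^ 2)) * βi ^ 5 := mul_le_mul_of_nonneg_right h2 (by positivity)
      _ = Cpre * Real.exp ((F.L ^ j - 1) * pg ^ 2) * βi ^ 5 := by ring
  -- Step 3 (ii): the exponent `βK a²/4 = L^j (b/b₀)² pg² / (4 Λ_L^{2j}) ≥ L^j pg²`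
  have hβθ : βi * θ ^ 2 = (b / b₀) ^ 2 * pg ^ 2 := by
    rw [hθ, beta_mul_θBal_sq F hγ b p₀ i, pFun_eq_div_mul hb₀.ne' p₀ (Real.sqrt x), mul_pow]
  have hratio : 4 * ((151 * (F.L : ℝ) ^ 2) ^ j) ^ 2 ≤ (b / b₀) ^ 2 := by
    have h1 : 2 * (151 * (F.L : ℝ) ^ 2) ^ j ≤ b / b₀ := by
      rw [le_div_iff₀ hb₀]; exact hb
    have h0 : 0 ≤ 2 * (151 * (F.L : ℝ) ^ 2) ^ j := by positivity
    calc 4 * ((151 * (F.L : ℝ) ^ 2) ^ j) ^ 2 = (2 * (151 * (F.L : ℝ) ^ 2) ^ j) ^ 2 := by ring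
      _ ≤ (b / b₀) ^ 2 := pow_le_pow_left₀ h0 h1 2
  have hexp_ge : (F.L : ℝ) ^ j * pg ^ 2 ≤ βK * a ^ 2 / 4 := by
    have hrew : βK * a ^ 2 / 4 = (F.L : ℝ) ^ j * (βi * θ ^ 2) / (4 * ((151 * (F.L : ℝ) ^ 2) ^ j) ^ 2) := by
      rw [ha, hβKeq, div_pow]
      field_simp
    rw [hrew, hβθ, le_div_iff₀ (by positivity)]
    have hLj0 : 0 ≤ (F.L : ℝ) ^ j * pg ^ 2 := by positivity
    calc (F.L : ℝ) ^ j * pg ^ 2 * (4 * ((151 * (F.L : ℝ) ^ 2) ^ j) ^ 2)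
        = ((F.L : ℝ) ^ j * pg ^ 2) * (4 * ((151 * (F.L : ℝ) ^ 2) ^ j) ^ 2) := by ring
      _ ≤ ((F.L : ℝ) ^ j * pg ^ 2) * (b / b₀) ^ 2 := mul_le_mul_of_nonneg_left hratio hLj0
      _ = (F.L : ℝ) ^ j * ((b / b₀) ^ 2 * pg ^ 2) := by ring
  have hgauss : Real.exp (-(βK * a ^ 2 / 4)) ≤ Real.exp (-((F.L ^ j - 1) * pg ^ 2)) * Real.exp (-(pg ^ 2)) := by
    rw [← Real.exp_add]
    refine Real.exp_le_exp.mpr ?_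
    have : -(((F.L : ℝ) ^ j - 1) * pg ^ 2) + -(pg ^ 2) = -((F.L : ℝ) ^ j * pg ^ 2) := by ring
    rw [this]
    exact neg_le_neg hexp_ge
  -- assemble
  have hE : Real.exp ((F.L ^ j - 1) * pg ^ 2) * Real.exp (-((F.L ^ j - 1) * pg ^ 2)) = 1 := by
    rw [← Real.exp_add, add_neg_cancel, Real.exp_zero]
  have hpre0 : 0 ≤ 2 * Real.exp 24 * (c₀ ^ 3)⁻¹ := by positivity
  calc (T.card : ℝ) * (2 * Real.exp 24 * (c₀ ^ 3)⁻¹ * Real.sqrt βK ^ 9 * Real.exp (-(βK * a ^ 2 / 4)))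
      = 2 * Real.exp 24 * (c₀ ^ 3)⁻¹ * ((T.card : ℝ) * Real.sqrt βK ^ 9) * Real.exp (-(βK * a ^ 2 / 4)) := by ring
    _ ≤ 2 * Real.exp 24 * (c₀ ^ 3)⁻¹ * (Cpre * Real.exp ((F.L ^ j - 1) * pg ^ 2) * βi ^ 5) *
          (Real.exp (-((F.L ^ j - 1) * pg ^ 2)) * Real.exp (-(pg ^ 2))) := by
        gcongr
    _ = 2 * Real.exp 24 * (c₀ ^ 3)⁻¹ * Cpre * βi ^ 5 *
          (Real.exp ((F.L ^ j - 1) * pg ^ 2) * Real.exp (-((F.L ^ j - 1) * pg ^ 2))) * Real.exp (-(pg ^ 2)) := by ring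
    _ = 2 * Real.exp 24 * (c₀ ^ 3)⁻¹ * Cpre * βi ^ 5 * Real.exp (-(pg ^ 2)) := by rw [hE, mul_one]

/-- **THE SANDWICH PIECE AT LARGE LADDER BASE, EVERY DEPTH** (the registered sandwich letters: `γ₁ = 1`, `c = 1`, `N = 5`): for every `L`, `b₀ > 0`,
`p₀ > 2`, `Λ > 1` there are `γ₁, C, c, N` such that for every `F` (`F.L = L`), `0 < γ ≤ γ₁`, every `b ≥ b₀`, every `K n j` with `j + n ≤ K` AND
`2·(151L²)^j·b₀ ≤ b`, and every `p`: `Gibbs_K{finer θ_b-small ∧ coarser θ_{Λb}-small ∧ θ_b(K−j) ≤ |Ū^{j}(∂p) − 1|} ≤ C·β_{K−j}^N·exp(−c·p(g_{K−j})(b₀)²)`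
— no coupling `N₁·j + n ≤ K`, no regime on `θ_{Λb}`: the crude envelope of `stub_sandwichSweepGap` and `stub_sandwichDeep` in the severity ladder.
[cite: Balaban1985Averaging, Prop. 1 (51) p.26; Balaban1985UV3, (7) p.257 and (71) p.273; FrohlichIsraelLiebSimon1978, Thm 4.1] -/
theorem sandwichTail_of_large_base : ∀ (L : ℕ) (b₀ p₀ Λ : ℝ), 0 < b₀ → 2 < p₀ → 1 < Λ →
    ∃ (γ₁ C c : ℝ) (N : ℕ), 0 < γ₁ ∧ γ₁ ≤ 1 ∧ 0 < c ∧ ∀ (F : T3Family) (γ : ℝ), F.L = L → 0 < γ → γ ≤ γ₁ →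
      ∀ (b : ℝ), b₀ ≤ b → ∀ (K n j : ℕ), j + n ≤ K → 2 * (151 * (L : ℝ) ^ 2) ^ j * b₀ ≤ b → ∀ p : Plaq (F.P K) j,
        (T3UnitScaleTilt.gibbsK F T3UnitLawDensityEML.ℰp γ K).real
          {U | (∀ k, k < j → PlaqSmall (T3UnitScaleTilt.θBal F.L γ b p₀ (K - k))
                (Averaging.iter (fun i => BlockAveraging.blockAvg (P := F.P K) (j := i) T3UnitLawDensityEML.ℰp) k U)) ∧
              (∀ j', j ≤ j' → j' + n ≤ K → PlaqSmall (T3UnitScaleTilt.θBal F.L γ (Λ * b) p₀ (K - j'))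
                (Averaging.iter (fun i => BlockAveraging.blockAvg (P := F.P K) (j := i) T3UnitLawDensityEML.ℰp) j' U)) ∧
              T3UnitScaleTilt.θBal F.L γ b p₀ (K - j) ≤ GaugeGroup.dist1 (GaugeField.plaqHol
                (Averaging.iter (fun i => BlockAveraging.blockAvg (P := F.P K) (j := i) T3UnitLawDensityEML.ℰp) j U) p)}
        ≤ C * ((γ * ((F.L : ℝ)⁻¹) ^ (K - j))⁻¹) ^ N *
            Real.exp (-(c * B10.pFun b₀ p₀ (Real.sqrt (γ * ((F.L : ℝ)⁻¹) ^ (K - j))) ^ 2)) := by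
  intro L b₀ p₀ Λ hb₀ hp₀ _hΛ
  obtain ⟨C, _hC, h⟩ := perPlaquette_of_large_base L hb₀ (by linarith : 0 < p₀)
  refine ⟨1, C, 1, 5, one_pos, le_rfl, one_pos, fun F γ hFL hγ hγ1 b _hb K n j hjK hbj p => ?_⟩
  haveI := isProbabilityMeasure_gibbsK F ℰp hγ.le K
  have hjK' : j ≤ K := le_trans (Nat.le_add_right j n) hjK
  have hL : 2 * (151 * (L : ℝ) ^ 2) ^ j * b₀ ≤ b := hbj
  have hmain := h F hFL γ hγ hγ1 b K j hjK' hL p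
  rw [one_mul]
  refine le_trans (measureReal_mono (fun U hU => ?_) (measure_ne_top _ _)) hmain
  exact hU.2.2

end Main

end Summit.QuantumFields.YangMills.Theorems.CovariantDischargeSandwichLargeBase

end
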